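import Mathlib
import Summits.Ventures.PercRepro.TriangleCapOneTriangleTwoBelowB
import Summits.Ventures.PercRepro.TriangleCapSubDiagonalTriangles
import Summits.Ventures.PercRepro.TriangleCapTriangleFreeTwoB

/-!
# PercRepro — TWO BELOW THE DIAGONAL ON THE `K₄⁻`-FREE CLASS, ASSEMBLED MODULO THE TWO-TRIANGLE CASE
(p3, gen 36; part 50)

`dense_stability_two_modulo_two_triangles`: for `k ≥ 12`, a `K₄⁻`-free graph with `m ≥ 2k − 3` edges that is not
bipartite spanning with at most one missing cross pair has `Σ_v d(v)² + 2 (k − 3) ≤ m·k`, PROVIDED the two-triangle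
case holds — stated as the explicit hypothesis `hTwo`: every `K₄⁻`-free graph on `k ≥ 12` vertices with
`m ≥ 2k − 3` edges and two triangles `u v w`, `a b c` (`a ∉ {u, v, w}`) such that every triangle vertex lies in
`{u, v, w, a, b, c}` satisfies the bound.  The other cases are theorems: triangle-free
(TriangleCapTriangleFreeTwoB), one triangle (TriangleCapOneTriangleTwoBelowB, `k ≥ 10`), three triangles with a
vertex off the first two (TriangleCapSubDiagonalTriangles, `k ≥ 12`).  This is the exact remaining obstacle to the
`K₄⁻`-free cells two below the diagonal (§10az(k′)); it is NOT a claim about that case.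
Axioms: standard (the hypothesis `hTwo` is a plain hypothesis, not an axiom).
-/

namespace PercRepro

namespace TriangleCap

namespace C047

open Finset

variable {V : Type*} [Fintype V] [DecidableEq V]

/-- **TWO BELOW THE DIAGONAL, `K₄⁻`-FREE, `k ≥ 12`, MODULO THE TWO-TRIANGLE CASE `hTwo`.** -/
theorem dense_stability_two_modulo_two_triangles (D : SimpleGraph V) [DecidableRel D.Adj] (hK : K4mFree D)
    (hk : 12 ≤ Fintype.card V) (hm : 2 * Fintype.card V ≤ D.edgeFinset.card + 3)
    (hnot : ¬ ∃ A : Finset V, (∀ x y, D.Adj x y → (x ∈ A ↔ y ∉ A)) ∧ (missing D A Aᶜ).card ≤ 1)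
    (hTwo : ∀ u v w a b c : V, D.Adj u v → D.Adj u w → D.Adj v w → D.Adj a b → D.Adj a c → D.Adj b c →
      ¬ (a = u ∨ a = v ∨ a = w) →
      (∀ x y z, D.Adj x y → D.Adj x z → D.Adj y z → x = u ∨ x = v ∨ x = w ∨ x = a ∨ x = b ∨ x = c) →
      ∑ v, deg D v * deg D v + 2 * (Fintype.card V - 3) ≤ D.edgeFinset.card * Fintype.card V) :
    ∑ v, deg D v * deg D v + 2 * (Fintype.card V - 3) ≤ D.edgeFinset.card * Fintype.card V := by
  by_cases hfree : D.CliqueFree 3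
  · exact triangle_free_stability_two D hfree hm hnot
  · obtain ⟨S, hS⟩ := not_forall.mp hfree
    have hS' := not_not.mp hS
    rw [SimpleGraph.is3Clique_iff] at hS'
    obtain ⟨u, v, w, huv, huw, hvw, -⟩ := hS'
    by_cases hT : ∀ a b c, D.Adj a b → D.Adj a c → D.Adj b c → a = u ∨ a = v ∨ a = w
    · exact one_triangle_stability_two D hK (by omega) huv huw hvw hT hm
    · simp only [not_forall, not_or] at hT
      obtain ⟨a, b, c, hab, hac, hbc, hau, hav, haw⟩ := hT
      have ha : ¬ (a = u ∨ a = v ∨ a = w) := fun h => by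
        rcases h with h | h | h
        · exact hau h
        · exact hav h
        · exact haw h
      by_cases hT3 : ∀ x y z, D.Adj x y → D.Adj x z → D.Adj y z →
          x = u ∨ x = v ∨ x = w ∨ x = a ∨ x = b ∨ x = c
      · exact hTwo u v w a b c huv huw hvw hab hac hbc ha hT3
      · simp only [not_forall, not_or] at hT3
        obtain ⟨x, y, z, hxy, hxz, hyz, hxu, hxv, hxw, hxa, hxb, hxc⟩ := hT3
        exact stability_two_of_three_triangles D hK hk huv huw hvw hab hac hbc ha hxy hxz hyz
          (fun h => by
            rcases h with h | h | h | h | h | h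
            · exact hxu h
            · exact hxv h
            · exact hxw h
            · exact hxa h
            · exact hxb h
            · exact hxc h)

end C047

end TriangleCap

end PercRepro
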